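import Summits.BirchSwinnertonDyer.BirchSwinnertonDyer.Theorems.KatoDescentPotSupersingularKatoFiniteLevelStrictKato1416
import Literature.NumberTheory.EllipticCurves.Kato2004.IntegralH1FiniteProofs
import HarnessLib

/-!
# Kato's (14.9.3) at finite level, part 20: saturation at the GOOD primes — `A ∩ p^k H¹(ℚ,T_pE)` vs `p^k A` — and the case of
# good reduction outside `p`: `#(H¹(ℤ[1/p],T_pE) / p^k) ≤ #Ш(E/ℚ)[p^∞] · #E(ℚ_p)[p^k] · p^k` for all large `k`
# (route `KatoDescentPotSupersingular` / `…Tame…`, crux M = stmt-BirchSwinnertonDyer-19196 `ReducibleKatoMember`; route-free helper)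

Seat `bsd-potss-rkm` g17 (prover; cell `bsd-potss`), item stmt-BirchSwinnertonDyer-19196 (`--supports … --as helper`; closes
nothing).  HONEST FRAMING: BSD is not proved by any of this; nothing is booked; theorems only (no definition, no named fact).

Part 19 bounds `#(A ⧸ (A ∩ p^k H¹(⊤,T_pE)))`, `A = Kato2004.integralH1 (tateRep W p) p ⊤ = H¹(ℤ[1/p],T_pE)`.  Kato's own quotient
is `A/p^k A`; the two differ by the SATURATION defect `[A ∩ p^k H¹ : p^k A]`, which lives at the bad primes `ℓ ≠ p` only:

* **`resLe_inertia_eq_zero_of_pow_smul_mem_integralH1`** — at a prime `𝔓` over a GOOD `v ≠ v_p`, if `p^k • c ∈ A` then `c` is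
  already integral at `𝔓` (`H¹(I_𝔓, T_pE)` has no `p`-torsion when `I_𝔓` acts trivially — tree
  `IntegralH1Finite.eq_zero_of_prime_smul_eq_zero_of_forall_smul_eq`, iterated `k` times; AEC VII.4.1).
* **`mem_integralH1_of_pow_smul_mem_of_good_outside`** — if `E` has good reduction at every prime `≠ p`, then
  `p^k • c ∈ A ⟹ c ∈ A`, i.e. `A ∩ p^k H¹(⊤,T_pE) = p^k A`.
* **`natCard_integralH1_quot_pow_le_of_good_outside`** — for `E/ℚ` with good reduction outside `p` (e.g. conductor a power of
  `p`), `p` odd, rank `0`, `Ш(E/ℚ)[p^∞]` finite, `SelmerComplement` for `LocalInvariants.canonical ℚ (p^k)`: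
  `∃ k₀ ∀ k ≥ k₀: #(A ⧸ p^k A) ≤ #Ш(E/ℚ)[p^∞] · (#E(ℚ_p)[p^k] · p^k)` — Kato's Prop. 14.16 (2) kernel half with NO Tamagawa factor
  and no inertia hypothesis (there are no bad `ℓ ≠ p`).

References: K. Kato, Astérisque 295 (2004) §8.2, §13.8, Prop. 14.16 [Kato2004Asterisque]; J. H. Silverman, *AEC* VII.4.1 [SilvermanAEC2009].
-/

-- the summit and its single problem are both named `BirchSwinnertonDyer` (registry layout D-0017)
set_option linter.dupNamespace false
set_option autoImplicit false

noncomputable section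

open scoped Classical ContRepresentation NumberField
open Function Field NumberField IsDedekindDomain
open Literature.NumberTheory.EllipticCurves Literature.NumberTheory.GaloisRepresentations
  Literature.NumberTheory.GaloisRepresentations.DiscreteGaloisModule Literature.NumberTheory.GaloisCohomology
open Literature.NumberTheory.EllipticCurves.Kato2004 Literature.NumberTheory.EllipticCurves.Kato2004.EulerSystemValues
  Literature.NumberTheory.EllipticCurves.Kato2004.IntegralH1Finite
open Summit.BirchSwinnertonDyer.Rank1Residual.X11b.LocBridge

namespace Summit.BirchSwinnertonDyer.BirchSwinnertonDyer.Theorems.KatoFiniteLevelCount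

section GoodOutsideP

variable (W : WeierstrassCurve ℚ) [W.IsElliptic] (p : ℕ) [Fact p.Prime] [ContinuousSMul ℤ_[p] (W.tateModule p)]

/-- **Saturation at a good prime**: at `𝔓` over a good `v` with residue characteristic `≠ p`, `p^k • c ∈ H¹(ℤ[1/p], T_pE)` forces
`res_{I_𝔓} c = 0` — `H¹(I_𝔓, T_pE)` has no `p`-torsion since `I_𝔓` acts trivially (tree
`eq_zero_of_prime_smul_eq_zero_of_forall_smul_eq`, `forall_smul_eq_of_hasGoodReductionAt`).
[cite: SilvermanAEC2009, Prop. VII.4.1(b)] [cite: Kato2004Asterisque, §8.2 (p. 180)] -/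
theorem resLe_inertia_eq_zero_of_pow_smul_mem_integralH1 {v : HeightOneSpectrum (𝓞 ℚ)} (hgood : W.HasGoodReductionAt v)
    (hvp : ((Rat.HeightOneSpectrum.primesEquiv v : Nat.Primes) : ℕ) ≠ p)
    {𝔓 : Ideal (absIntegers (𝓞 ℚ) ℚ)} (h𝔓 : 𝔓 ∈ v.primesAbove) (k : ℕ) (c : H1 (tateRep W p) ⊤)
    (hc : ((p : ℤ_[p]) ^ k) • c ∈ integralH1 (tateRep W p) p ⊤) :
    resLe (tateRep W p).toTopRep
      (inf_le_left : (⊤ : Subgroup (absoluteGaloisGroup ℚ)) ⊓ 𝔓.inertia (absoluteGaloisGroup ℚ) ≤ ⊤) 1 c = 0 := by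
  have hV := forall_smul_eq_of_hasGoodReductionAt W p hgood hvp h𝔓
  have h0 : ((p : ℤ_[p]) ^ k) • resLe (tateRep W p).toTopRep
      (inf_le_left : (⊤ : Subgroup (absoluteGaloisGroup ℚ)) ⊓ 𝔓.inertia (absoluteGaloisGroup ℚ) ≤ ⊤) 1 c = 0 := by
    rw [← map_smul]
    exact (mem_integralH1_iff _ p ⊤ _).mp hc v hvp 𝔓 h𝔓
  have key : ∀ (j : ℕ) (r : H1 (tateRep W p) ((⊤ : Subgroup (absoluteGaloisGroup ℚ)) ⊓ 𝔓.inertia (absoluteGaloisGroup ℚ))),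
      ((p : ℤ_[p]) ^ j) • r = 0 → r = 0 := by
    intro j
    induction j with
    | zero => intro r hr; rwa [pow_zero, one_smul] at hr
    | succ j ih =>
      intro r hr
      apply ih
      apply eq_zero_of_prime_smul_eq_zero_of_forall_smul_eq W p _ hV
      rw [smul_smul, ← pow_succ']
      exact hr
  exact key k _ h0

/-- **Good reduction outside `p` ⟹ `A` is `p`-saturated in `H¹(ℚ, T_pE)`**: `p^k • c ∈ A ⟹ c ∈ A`
(`A = H¹(ℤ[1/p], T_pE)`), i.e. `A ∩ p^k H¹(⊤, T_pE) = p^k A`. [cite: Kato2004Asterisque, §8.2 (p. 180)] [cite: SilvermanAEC2009, Prop. VII.4.1(b)] -/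
theorem mem_integralH1_of_pow_smul_mem_of_good_outside
    (hgood : ∀ v : HeightOneSpectrum (𝓞 ℚ), v ≠ primePlace p → W.HasGoodReductionAt v) (k : ℕ) (c : H1 (tateRep W p) ⊤)
    (hc : ((p : ℤ_[p]) ^ k) • c ∈ integralH1 (tateRep W p) p ⊤) : c ∈ integralH1 (tateRep W p) p ⊤ := by
  refine (mem_integralH1_iff _ p ⊤ c).mpr fun v hvp 𝔓 h𝔓 => ?_
  have hv : v ≠ primePlace p := fun h => hvp (by rw [h]; exact coe_primesEquiv_primePlace p)
  exact resLe_inertia_eq_zero_of_pow_smul_mem_integralH1 W p (hgood v hv) hvp h𝔓 k c hc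

/-- **Kato's Prop. 14.16 (2), kernel half, for curves with good reduction outside `p`**: `E/ℚ`, `p` odd, good reduction at every
prime `≠ p`, `E(ℚ)` finite, `Ш(E/ℚ)[p^∞]` finite, `SelmerComplement` for `LocalInvariants.canonical ℚ (p^k)` (all `k`):
`∃ k₀ ∀ k ≥ k₀`, **`#(A ⧸ p^k A) ≤ #Ш(E/ℚ)[p^∞] · (#E(ℚ_p)[p^k] · p^k)`**, `A = H¹(ℤ[1/p], T_pE) = Kato2004.integralH1 (tateRep W p) p ⊤`.
[cite: Kato2004Asterisque, §13.8 (p. 228), (14.9.3) (p. 240), Prop. 14.16 (pp. 244–245)] -/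
theorem natCard_integralH1_quot_pow_le_of_good_outside (hodd : p ≠ 2)
    (hgood : ∀ v : HeightOneSpectrum (𝓞 ℚ), v ≠ primePlace p → W.HasGoodReductionAt v)
    [Finite W.toAffine.Point] [Finite (AddCommGroup.primaryComponent W.sha p)]
    (hSC : ∀ k : ℕ, (LocalInvariants.canonical ℚ (p ^ k)).SelmerComplement) :
    ∃ k₀ : ℕ, ∀ k, k₀ ≤ k →
      Nat.card (integralH1 (tateRep W p) p ⊤ ⧸
          (LinearMap.range (DistribSMul.toLinearMap ℤ_[p] (integralH1 (tateRep W p) p ⊤)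
            ((p : ℤ_[p]) ^ k))).toAddSubgroup) ≤
        Nat.card (AddCommGroup.primaryComponent W.sha p) *
          (Nat.card (nsmulAddMonoidHom (p ^ k) :
            (W.baseChange ((primePlace p).adicCompletion ℚ)).toAffine.Point →+ _).ker * p ^ k) := by
  obtain ⟨k₀, hk₀⟩ := natCard_integralH1_quot_le_sha_points W p hodd {primePlace p} (Finset.mem_singleton_self _)
    (fun v hv => hgood v (fun h => hv (Finset.mem_singleton.2 h))) (fun v hv => by simp at hv)
    hSC
  refine ⟨k₀, fun k hk => ?_⟩
  have h := hk₀ k hk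
  rw [Finset.sdiff_self, Finset.prod_empty, mul_one] at h
  -- the two subgroups agree: `A ∩ p^k H¹ = p^k A`
  have heq : AddSubgroup.comap (integralH1 (tateRep W p) p ⊤).toAddSubgroup.subtype
      (LinearMap.range (DistribSMul.toLinearMap ℤ_[p] (H1 (tateRep W p) ⊤) ((p : ℤ_[p]) ^ k))).toAddSubgroup =
      (LinearMap.range (DistribSMul.toLinearMap ℤ_[p] (integralH1 (tateRep W p) p ⊤)
        ((p : ℤ_[p]) ^ k))).toAddSubgroup := by
    ext a
    simp only [AddSubgroup.mem_comap, Submodule.mem_toAddSubgroup, LinearMap.mem_range, DistribSMul.toLinearMap_apply]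
    constructor
    · rintro ⟨c, hc⟩
      have hcA : c ∈ integralH1 (tateRep W p) p ⊤ :=
        mem_integralH1_of_pow_smul_mem_of_good_outside W p hgood k c (by rw [hc]; exact a.2)
      exact ⟨⟨c, hcA⟩, Subtype.ext hc⟩
    · rintro ⟨a', ha'⟩
      exact ⟨(a' : H1 (tateRep W p) ⊤), by rw [← ha']; rfl⟩
  rw [← heq]
  exact h

end GoodOutsideP

end Summit.BirchSwinnertonDyer.BirchSwinnertonDyer.Theorems.KatoFiniteLevelCount

end
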